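import Literature.Analysis.FluidPDE.OnsagerBDSVTransportHigher
import HarnessLib

/-!
# The BDSV perturbation: all-order bounds for the backward flows (App. B (B.5), Prop. 5.7)

Buckmaster–De Lellis–Székelyhidi–Vicol (BDSV), *Onsager's conjecture for admissible weak
solutions*, CPAM 72 (2019) = arXiv:1701.08678. App. B, Prop. B.1 (= Prop. 9.1 of the arXiv
version): for the inverse `Φ` of the flux of a smooth velocity field `v` started at `t₀` as the
identity and `|t - t₀| ‖v‖₁ ≤ 1`,
(B.5) "`[Φ(t)]_N ≲ |t - t₀| [v]_N` for all `N ≥ 2`" ("standard estimates", proof referred to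
Buckmaster–De Lellis–Isett–Székelyhidi 2015); this is the input of Prop. 5.7, arXiv (5.23):
"`‖∇Φ_i‖_N ≲ 1 + τ_q‖Dv̄_q‖_N ≲ 1 + τ_q δ_q^{1/2} λ_q ℓ^{-N}`" on the intervals `Ĩ_i` of length
`∼ τ_q`, where (2.19) `‖v̄_q‖_{N+1} ≲ δ_q^{1/2} λ_q ℓ^{-N}`.

This file PROVES the all-order flow bound in the scale-graded form in which §5.5 consumes it,
for the displacement `D = Φ - id` of a backward flow on a window `[a,b] × T^d` (transport of the
identity: `∂ₜD + (v·∇)D = -v`, `D(t₀) = 0`):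

* `BDSV.eContDiffHolderNorm_flow_higher`: for every `N` there are constants `K = K(N,d) ≥ 0`,
  `A = A(N,d) ≥ 1` such that, if `‖Dv‖ ≤ K_v` with `K_v (b-a) ≤ 1/2`, the velocity obeys the graded
  bounds `‖v(s)‖_{j,0} ≤ W ℓ^{-(j-1)}` (`1 ≤ j ≤ N`, `ℓ > 0`) and `(b-a) W A ≤ 1`, then
  `‖D(s)‖_{m,0} ≤ K (b-a) W ℓ^{-(m-1)}` for all `s ∈ [a,b]` and `1 ≤ m ≤ N` — i.e. (B.5) with the
  loss of one power of `ℓ` per derivative inherited from the velocity. Proof: induction on `N`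
  through the level-`N` transport estimate `BDSV.eContDiffHolderNorm_transport_higher` (the
  forcing is `-v`, the datum vanishes, and the lower-order terms `V_{i+2} Φ_{N-1-i}` carry the
  total weight `ℓ^{-(N-1)}`), absorbing `(b-a) W ≤ 1`.

## References

* T. Buckmaster, C. De Lellis, L. Székelyhidi Jr., V. Vicol, *Onsager's conjecture for admissible
  weak solutions*, Comm. Pure Appl. Math. 72 (2019) 229–274 = arXiv:1701.08678, App. B
  Prop. B.1 (B.5) (= arXiv §9, Prop. 9.1); §5.5 Prop. 5.7 (arXiv (5.23)) and its proof.
* T. Buckmaster, C. De Lellis, P. Isett, L. Székelyhidi Jr., *Anomalous dissipation for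
  `1/5`-Hölder Euler flows*, Ann. of Math. 182 (2015), App. (the detailed transport estimates).
-/

noncomputable section

open MeasureTheory Set Filter Function
open scoped NNReal ENNReal ContDiff Topology

namespace Literature.Analysis.FluidPDE

namespace BDSV

open FunctionSpaces FunctionSpaces.Torus

variable {d : Type} [Fintype d] [DecidableEq d] {F : Type} [NormedAddCommGroup F] [NormedSpace ℝ F]

omit [DecidableEq d] in
/-- A slice that vanishes identically has `C^{k,r}` norm zero. [folklore] -/
theorem eContDiffHolderNorm_of_forall_eq_zero {g : UnitAddTorus d → F} (h : ∀ x, g x = 0)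
    (k : ℕ) (r : ℝ≥0) : Torus.eContDiffHolderNorm k r g = 0 := by
  have e : g = 0 := funext h
  rw [e]
  exact Torus.eContDiffHolderNorm_zero_fun k r

/-- `ℓ^{-i} ℓ^{-k} = ℓ^{-n}` whenever `i + k = n` (natural exponents, `ℓ > 0`). [folklore] -/
theorem rpow_neg_nat_mul_of_add_eq {ℓ : ℝ} (hℓ : 0 < ℓ) {i k n : ℕ} (h : i + k = n) :
    ℓ ^ (-(i : ℝ)) * ℓ ^ (-(k : ℝ)) = ℓ ^ (-(n : ℝ)) := by
  rw [← Real.rpow_add hℓ]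
  congr 1
  have e : ((i : ℝ) + (k : ℝ)) = n := by exact_mod_cast h
  linarith

/-- **All-order bounds for the displacement of a backward flow** (BDSV App. B (B.5):
"`[Φ(t)]_N ≲ |t - t₀|[v]_N`", in the graded form of Prop. 5.7, arXiv (5.23)). For every `N` there
are `K = K(N,d) ≥ 0` and `A = A(N,d) ≥ 1` with the following property. Let `v` be jointly smooth
on `[a,b] × T^d` (`a < b`) with `‖Dv‖ ≤ K_v`, `K_v (b-a) ≤ 1/2`, and with the graded bounds
`‖v(s)‖_{j,0} ≤ W ℓ^{-(j-1)}` for `1 ≤ j ≤ N` (`W ≥ 0`, `ℓ > 0`), where `(b-a) W A ≤ 1`; let `D` be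
jointly smooth with `∂ₜD + (v·∇)D = -v` on `[a,b] × T^d` and `D(t₀, ·) = 0` for some `t₀ ∈ [a,b]`
(so `Φ = id + D` is the backward flow of `v` anchored at `t₀`). Then for all `s ∈ [a,b]` and
`1 ≤ m ≤ N`, `‖D(s)‖_{m,0} ≤ K (b-a) W ℓ^{-(m-1)}`.
[cite: BuckmasterEtAl2018, App. B Prop. B.1 (B.5)] -/
theorem eContDiffHolderNorm_flow_higher (N : ℕ) :
    ∃ K A : ℝ, 0 ≤ K ∧ 1 ≤ A ∧ ∀ {a b : ℝ} (_ : a < b)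
      {v : ℝ → UnitAddTorus d → EuclideanSpace ℝ d} (_ : IsSmoothSpaceTimeOn (Icc a b) v)
      {Kv : ℝ≥0} (_ : ∀ s ∈ Icc a b, ∀ x, ‖Torus.fderiv (v s) x‖ ≤ Kv)
      (_ : (Kv : ℝ) * (b - a) ≤ 1 / 2) {W ℓ : ℝ} (_ : 0 ≤ W) (_ : 0 < ℓ)
      (_ : ∀ s ∈ Icc a b, ∀ j : ℕ, 1 ≤ j → j ≤ N →
        Torus.eContDiffHolderNorm j 0 (v s) ≤ ENNReal.ofReal (W * ℓ ^ (-((j - 1 : ℕ) : ℝ))))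
      (_ : (b - a) * W * A ≤ 1) {t₀ : ℝ} (_ : t₀ ∈ Icc a b)
      {D : ℝ → UnitAddTorus d → EuclideanSpace ℝ d} (_ : IsSmoothSpaceTimeOn (Icc a b) D)
      (_ : ∀ s ∈ Icc a b, ∀ x, timeDerivWithin (Icc a b) D s x + convect (v s) (D s) x = -v s x)
      (_ : ∀ x, D t₀ x = 0),
      ∀ s ∈ Icc a b, ∀ m : ℕ, 1 ≤ m → m ≤ N →
        Torus.eContDiffHolderNorm m 0 (D s) ≤
          ENNReal.ofReal (K * ((b - a) * W) * ℓ ^ (-((m - 1 : ℕ) : ℝ))) := by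
  induction N with
  | zero =>
    refine ⟨0, 1, le_rfl, le_rfl, ?_⟩
    intro _ _ _ _ _ _ _ _ _ _ _ _ _ _ _ _ _ _ _ _ _ _ _ hm hm0
    exact absurd (hm.trans hm0) (by norm_num)
  | succ N IH =>
    obtain ⟨K, A, hK0, hA1, hIH⟩ := IH
    obtain ⟨A', hA'1, hT⟩ :=
      eContDiffHolderNorm_transport_higher (d := d) (F := EuclideanSpace ℝ d) (N + 1)
    have hA'0 : 0 ≤ A' := zero_le_one.trans hA'1
    have hNK : 0 ≤ (N : ℝ) * K := mul_nonneg (Nat.cast_nonneg N) hK0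
    refine ⟨max K (A' * (1 + N * K)), max A A', le_max_of_le_left hK0, le_max_of_le_left hA1, ?_⟩
    intro a b hab v hv Kv hKv hKL W ℓ hW hℓ hV hsmall t₀ ht₀ D hD heq h0 s hs m hm hmN
    have hL : 0 < b - a := sub_pos.2 hab
    have hX0 : 0 ≤ (b - a) * W := mul_nonneg hL.le hW
    -- smallness at both levels, and `(b - a) W ≤ 1`
    have hsmallA : (b - a) * W * A ≤ 1 :=
      le_trans (mul_le_mul_of_nonneg_left (le_max_left A A') hX0) hsmall
    have hsmallA' : (b - a) * W * A' ≤ 1 :=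
      le_trans (mul_le_mul_of_nonneg_left (le_max_right A A') hX0) hsmall
    have hX1 : (b - a) * W ≤ 1 := by
      have h := mul_le_mul_of_nonneg_left hA1 hX0
      rw [mul_one] at h
      exact h.trans hsmallA
    -- the lower orders from the induction hypothesis
    have hlow : ∀ s ∈ Icc a b, ∀ m : ℕ, 1 ≤ m → m ≤ N →
        Torus.eContDiffHolderNorm m 0 (D s) ≤
          ENNReal.ofReal (K * ((b - a) * W) * ℓ ^ (-((m - 1 : ℕ) : ℝ))) :=
      hIH hab hv hKv hKL hW hℓ (fun s hs j hj hjN => hV s hs j hj (hjN.trans (Nat.le_succ N)))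
        hsmallA ht₀ hD heq h0
    rcases Nat.of_le_succ hmN with hmle | hmeq
    · -- `m ≤ N`: the induction hypothesis, with the larger constant
      refine (hlow s hs m hm hmle).trans (ENNReal.ofReal_le_ofReal ?_)
      exact mul_le_mul_of_nonneg_right (mul_le_mul_of_nonneg_right (le_max_left _ _) hX0)
        (Real.rpow_nonneg hℓ.le _)
    · -- `m = N + 1`: the level-`N+1` transport estimate
      rw [hmeq]
      set V : ℕ → ℝ := fun j => W * ℓ ^ (-((j - 1 : ℕ) : ℝ)) with hVdef
      have hV0 : ∀ j, 0 ≤ V j := fun j => mul_nonneg hW (Real.rpow_nonneg hℓ.le _)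
      have hVb : ∀ s ∈ Icc a b, ∀ j : ℕ, 1 ≤ j → j ≤ N + 1 →
          Torus.eContDiffHolderNorm j 0 (v s) ≤ ENNReal.ofReal (V j) := hV
      have hV1 : V 1 = W := by simp [hVdef]
      have hsmallT : (b - a) * V 1 * A' ≤ 1 := by rw [hV1]; exact hsmallA'
      set Φ : ℕ → ℝ := fun m => K * ((b - a) * W) * ℓ ^ (-((m - 1 : ℕ) : ℝ)) with hΦdef
      have hΦ0 : ∀ m, 0 ≤ Φ m := fun m =>
        mul_nonneg (mul_nonneg hK0 hX0) (Real.rpow_nonneg hℓ.le _)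
      have hΦb : ∀ s ∈ Icc a b, ∀ m : ℕ, 1 ≤ m → m < N + 1 →
          Torus.eContDiffHolderNorm m 0 (D s) ≤ ENNReal.ofReal (Φ m) :=
        fun s hs m hm hmN => hlow s hs m hm (Nat.lt_succ_iff.1 hmN)
      have hG : IsSmoothSpaceTimeOn (Icc a b) (fun s x => -v s x) := hv.neg
      have hF₀ : Torus.eContDiffHolderNorm (N + 1) 0 (D t₀) ≤ ENNReal.ofReal 0 := by
        rw [eContDiffHolderNorm_of_forall_eq_zero h0]
        exact bot_le
      set G₀ : ℝ := W * ℓ ^ (-(N : ℝ)) with hG₀def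
      have hG₀0 : 0 ≤ G₀ := mul_nonneg hW (Real.rpow_nonneg hℓ.le _)
      have hGb : ∀ s ∈ Icc a b,
          Torus.eContDiffHolderNorm (N + 1) 0 (fun x => -v s x) ≤ ENNReal.ofReal G₀ := by
        intro s hs
        show Torus.eContDiffHolderNorm (N + 1) 0 (-(v s)) ≤ _
        rw [Torus.eContDiffHolderNorm_neg]
        have h := hV s hs (N + 1) (Nat.succ_pos N) le_rfl
        rw [show N + 1 - 1 = N from rfl] at h
        exact h
      have key := hT hab zero_le_one hv hKv hKL hV0 ht₀ hVb hsmallT hD hG heq hΦ0 hΦb le_rfl hG₀0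
        hF₀ hGb s hs
      refine key.trans (ENNReal.ofReal_le_ofReal ?_)
      rw [show N + 1 - 1 = N from rfl]
      -- the lower-order sum: `N` equal terms `K (b-a) W² ℓ^{-N}`
      have hterm : ∀ i ∈ Finset.range N,
          V (i + 2) * Φ (N - i) = K * ((b - a) * W) * W * ℓ ^ (-(N : ℝ)) := by
        intro i hi
        have hiN : i < N := Finset.mem_range.1 hi
        have e : ℓ ^ (-((i + 2 - 1 : ℕ) : ℝ)) * ℓ ^ (-((N - i - 1 : ℕ) : ℝ)) =
            ℓ ^ (-(N : ℝ)) :=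
          rpow_neg_nat_mul_of_add_eq hℓ (by omega)
        simp only [hVdef, hΦdef]
        calc W * ℓ ^ (-((i + 2 - 1 : ℕ) : ℝ)) *
              (K * ((b - a) * W) * ℓ ^ (-((N - i - 1 : ℕ) : ℝ)))
            = K * ((b - a) * W) * W *
                (ℓ ^ (-((i + 2 - 1 : ℕ) : ℝ)) * ℓ ^ (-((N - i - 1 : ℕ) : ℝ))) := by ring
          _ = K * ((b - a) * W) * W * ℓ ^ (-(N : ℝ)) := by rw [e]
      rw [Finset.sum_congr rfl hterm, Finset.sum_const, Finset.card_range, nsmul_eq_mul, zero_add]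
      -- `A' (b-a) W ℓ^{-N} (1 + N K (b-a) W) ≤ max K (A'(1 + N K)) (b-a) W ℓ^{-N}`
      have hY0 : 0 ≤ ℓ ^ (-(N : ℝ)) := Real.rpow_nonneg hℓ.le _
      have h1 : (N : ℝ) * K * ((b - a) * W) ≤ N * K := by
        have h := mul_le_mul_of_nonneg_left hX1 hNK
        rwa [mul_one] at h
      calc A' * ((b - a) * G₀ + (b - a) * (N * (K * ((b - a) * W) * W * ℓ ^ (-(N : ℝ)))))
          = A' * (1 + N * K * ((b - a) * W)) * ((b - a) * W) * ℓ ^ (-(N : ℝ)) := by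
            rw [hG₀def]; ring
        _ ≤ A' * (1 + N * K) * ((b - a) * W) * ℓ ^ (-(N : ℝ)) := by
            refine mul_le_mul_of_nonneg_right (mul_le_mul_of_nonneg_right ?_ hX0) hY0
            exact mul_le_mul_of_nonneg_left (by linarith) hA'0
        _ ≤ max K (A' * (1 + N * K)) * ((b - a) * W) * ℓ ^ (-(N : ℝ)) :=
            mul_le_mul_of_nonneg_right (mul_le_mul_of_nonneg_right (le_max_right _ _) hX0) hY0

end BDSV

end Literature.Analysis.FluidPDE
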